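import Summits.NavierStokesRegularity.NavierStokesRegularity.Theorems.CircuitTrace.Negative.Structure

/-!
# `PerpetualPump.CircuitTrace` (crux stmt-NavierStokesRegularity-1836), line `tilted-trace-gronwall`,
# stub `stub_terminalTrace` (S5): terminal traces exist and inherit the `ℓ³` bound

Support file (everything proved, kind = proof) for the lead's reshaped skeleton of the line
`tilted-trace-gronwall`. For a solution `X` of Tao's viscous circuit system (`circuitRHS`,
`Theorems/CircuitTrace/Negative/LoadBearing.lean`) on `[0,T)` whose critical amplitudes
`a_{i,n}(t) = lam^{n/5}|X_{i,n}(t)|` have `Σ_{n∈s}Σ_i a_{i,n}(t)³ ≤ M` for every finite set of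
scales `s` and every `t ∈ [0,T)`:

* `terminalTrace_critSupBound`: the `ℓ³` bound gives the critical sup bound `a_{i,n}(t) ≤ max M 1`;
* `terminalTrace_limit`: under a critical sup bound every mode has a bounded derivative on `(0,T)`
  (the right-hand side at scale `n` only involves the finitely many structure constants and the
  modes at scales `n-1, n, n+1`), hence is Lipschitz there and has a limit at `T⁻` (Cauchy +
  completeness of `ℝ`) — adapted from the kernel-checked `terminalLimit` of
  `Cruxes/CircuitTrace/SketchIdeator2G2.lean`;
* `stub_terminalTrace`: the terminal trace `τ_{i,n} = lim_{t↑T} X_{i,n}(t)` exists for every mode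
  and, by passing to the limit in each FINITE sum (`le_of_tendsto` along `𝓝[<] T`), inherits
  `Σ_{n∈s}Σ_i (lam^{n/5}|τ_{i,n}|)³ ≤ M`.

No `def`s; the statement of `stub_terminalTrace` is verbatim the registered stub. [folklore]
-/

noncomputable section

set_option linter.dupNamespace false

namespace Summit.NavierStokesRegularity.NavierStokesRegularity.Theorems.PerpetualPumpCircuitTrace

open Finset Real Set Filter Topology
open Summit.NavierStokesRegularity.NavierStokesRegularity.Theorems.CircuitTrace.Negative

/-- From the `ℓ³` bound on finite sets of scales to the critical sup bound: taking `s = {n}` and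
dropping the other modes, `(lam^{n/5}|X_{i,n}(t)|)³ ≤ M`, hence `lam^{n/5}|X_{i,n}(t)| ≤ max M 1`
(if `x > max M 1 ≥ 1` then `x³ ≥ x > M`). -/
theorem terminalTrace_critSupBound {lam : ℝ} (hlam : 0 < lam) {m : ℕ} {T M : ℝ}
    {X : Fin m → ℤ → ℝ → ℝ}
    (hM : ∀ t ∈ Set.Ico 0 T, ∀ s : Finset ℤ,
      ∑ n ∈ s, ∑ i : Fin m, (lam ^ ((1 / 5 : ℝ) * n) * |X i n t|) ^ 3 ≤ M) :
    ∀ (i : Fin m) (n : ℤ), ∀ t ∈ Set.Ico 0 T, lam ^ ((1 / 5 : ℝ) * n) * |X i n t| ≤ max M 1 := by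
  intro i n t ht
  have h1 := hM t ht {n}
  rw [Finset.sum_singleton] at h1
  have hpow : 0 < lam ^ ((1 / 5 : ℝ) * n) := Real.rpow_pos_of_pos hlam _
  have h2 : (lam ^ ((1 / 5 : ℝ) * n) * |X i n t|) ^ 3
      ≤ ∑ j : Fin m, (lam ^ ((1 / 5 : ℝ) * n) * |X j n t|) ^ 3 :=
    Finset.single_le_sum (f := fun j => (lam ^ ((1 / 5 : ℝ) * n) * |X j n t|) ^ 3)
      (fun j _ => pow_nonneg (mul_nonneg hpow.le (abs_nonneg _)) 3) (Finset.mem_univ i)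
  set x : ℝ := lam ^ ((1 / 5 : ℝ) * n) * |X i n t| with hx
  have hx0 : 0 ≤ x := mul_nonneg hpow.le (abs_nonneg _)
  have hx3 : x ^ 3 ≤ M := h2.trans h1
  by_contra h
  rw [not_le] at h
  have hx1 : 1 < x := lt_of_le_of_lt (le_max_right _ _) h
  have hxM : M < x := lt_of_le_of_lt (le_max_left _ _) h
  have hxx : x ≤ x ^ 3 := by
    have : 1 ≤ x ^ 2 := by nlinarith
    nlinarith
  linarith

-- adapted from Cruxes/CircuitTrace/SketchIdeator2G2.lean (terminalLimit)
/-- TERMINAL LIMIT. Under a critical sup bound `lam^{n/5}|X_{i,n}(t)| ≤ A` on `[0,T)` every mode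
of a solution of the circuit system has a bounded derivative on `(0,T)`
(`|F_{i,n}| ≤ lam^{4n/5} c_n + Σ K lam^{n-[μ=e₃]} c c`, `c_k = A lam^{-k/5}`), hence is Lipschitz
on `(0,T)`, Cauchy at `T⁻`, and converges: the terminal state exists mode-wise. -/
theorem terminalTrace_limit {lam : ℝ} (hlam : 1 < lam) {m : ℕ}
    (coeff : Fin m → Fin m → Fin m → Option (Fin 3) → ℝ) (T : ℝ) (X : Fin m → ℤ → ℝ → ℝ)
    (hT : 0 < T)
    (hderiv : ∀ (i : Fin m) (n : ℤ), ∀ t ∈ Set.Ioo 0 T,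
      HasDerivAt (X i n) (circuitRHS lam coeff X i n t) t)
    (hA : ∃ A : ℝ, ∀ (i : Fin m) (n : ℤ), ∀ t ∈ Set.Ico 0 T,
      lam ^ ((1 / 5 : ℝ) * n) * |X i n t| ≤ A)
    (i : Fin m) (n : ℤ) :
    ∃ L : ℝ, Filter.Tendsto (X i n) (nhdsWithin T (Set.Iio T)) (nhds L) := by
  obtain ⟨A, hA⟩ := hA
  obtain ⟨K, hK0, hK⟩ := exists_coeff_bound coeff
  have hlam0 : 0 < lam := by linarith
  -- time-independent bounds on the modes
  set c : ℤ → ℝ := fun k => A / lam ^ ((1 / 5 : ℝ) * k) with hc_def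
  have hpow : ∀ k : ℤ, 0 < lam ^ ((1 / 5 : ℝ) * k) := fun k => Real.rpow_pos_of_pos hlam0 _
  have hc : ∀ (i' : Fin m) (k : ℤ), ∀ t ∈ Set.Ioo 0 T, |X i' k t| ≤ c k := by
    intro i' k t ht
    have h := hA i' k t ⟨ht.1.le, ht.2⟩
    rw [hc_def]
    simp only
    rw [le_div_iff₀ (hpow k)]
    linarith [mul_comm (lam ^ ((1 / 5 : ℝ) * k)) (|X i' k t|)]
  have hc0 : ∀ k : ℤ, 0 ≤ c k := fun k =>
    (abs_nonneg _).trans (hc i k (T / 2) ⟨by linarith, by linarith⟩)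
  -- the derivative bound
  set B : ℝ := lam ^ ((4 / 5 : ℝ) * n) * c n
      + ∑ i₁ : Fin m, ∑ i₂ : Fin m, ∑ μ : Option (Fin 3),
          K * lam ^ ((n : ℝ) - (if μ = some 2 then 1 else 0))
            * c (n + ((if μ = some 0 then 1 else 0) - (if μ = some 2 then 1 else 0)))
            * c (n + ((if μ = some 1 then 1 else 0) - (if μ = some 2 then 1 else 0))) with hB_def
  have hB : ∀ t ∈ Set.Ioo 0 T, |circuitRHS lam coeff X i n t| ≤ B := by
    intro t ht
    unfold circuitRHS
    refine (abs_add_le _ _).trans (add_le_add ?_ ?_)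
    · rw [abs_mul, abs_neg, abs_of_nonneg (Real.rpow_pos_of_pos hlam0 _).le]
      exact mul_le_mul_of_nonneg_left (hc i n t ht) (Real.rpow_pos_of_pos hlam0 _).le
    · refine (Finset.abs_sum_le_sum_abs _ _).trans (Finset.sum_le_sum fun i₁ _ => ?_)
      refine (Finset.abs_sum_le_sum_abs _ _).trans (Finset.sum_le_sum fun i₂ _ => ?_)
      refine (Finset.abs_sum_le_sum_abs _ _).trans (Finset.sum_le_sum fun μ _ => ?_)
      rw [abs_mul, abs_mul, abs_mul, abs_of_nonneg (Real.rpow_pos_of_pos hlam0 _).le]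
      have h1 := hK i₁ i₂ i μ
      have h2 := hc i₁ (n + ((if μ = some 0 then 1 else 0) - (if μ = some 2 then 1 else 0))) t ht
      have h3 := hc i₂ (n + ((if μ = some 1 then 1 else 0) - (if μ = some 2 then 1 else 0))) t ht
      have hl : 0 ≤ lam ^ ((n : ℝ) - (if μ = some 2 then 1 else 0)) :=
        (Real.rpow_pos_of_pos hlam0 _).le
      exact mul_le_mul (mul_le_mul (mul_le_mul_of_nonneg_right h1 hl) h2 (abs_nonneg _)
        (mul_nonneg hK0 hl)) h3 (abs_nonneg _) (mul_nonneg (mul_nonneg hK0 hl) (hc0 _))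
  have hB0 : 0 ≤ B := (abs_nonneg _).trans (hB (T / 2) ⟨by linarith, by linarith⟩)
  -- Lipschitz on (0,T)
  have hLip : ∀ s ∈ Set.Ioo 0 T, ∀ u ∈ Set.Ioo 0 T, ‖X i n u - X i n s‖ ≤ B * ‖u - s‖ := by
    intro s hs u hu
    refine (convex_Ioo 0 T).norm_image_sub_le_of_norm_hasDerivWithin_le
      (fun x hx => (hderiv i n x hx).hasDerivWithinAt) (fun x hx => ?_) hs hu
    rw [Real.norm_eq_abs]
    exact hB x hx
  -- Cauchy at T⁻
  have hC : Cauchy (Filter.map (X i n) (nhdsWithin T (Set.Iio T))) := by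
    refine Metric.cauchy_iff.2 ⟨inferInstance, fun ε hε => ?_⟩
    set δ : ℝ := ε / (2 * (B + 1)) with hδ
    have hδ0 : 0 < δ := by positivity
    set a : ℝ := max (T / 2) (T - δ) with ha
    have haT : a < T := max_lt (by linarith) (by linarith)
    have ha0 : 0 < a := lt_of_lt_of_le (by linarith) (le_max_left _ _)
    refine ⟨X i n '' Set.Ioo a T, Filter.image_mem_map (Ioo_mem_nhdsLT haT), ?_⟩
    rintro _ ⟨s, hs, rfl⟩ _ ⟨u, hu, rfl⟩
    have hs' : s ∈ Set.Ioo 0 T := ⟨ha0.trans hs.1, hs.2⟩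
    have hu' : u ∈ Set.Ioo 0 T := ⟨ha0.trans hu.1, hu.2⟩
    have h := hLip u hu' s hs'
    rw [Real.norm_eq_abs, Real.norm_eq_abs] at h
    rw [dist_eq_norm, Real.norm_eq_abs]
    have hsu : |s - u| ≤ δ := by
      have h1 : T - δ ≤ a := le_max_right _ _
      rw [abs_le]; constructor <;> linarith [hs.1, hs.2, hu.1, hu.2]
    calc |X i n s - X i n u| ≤ B * |s - u| := h
      _ ≤ B * δ := mul_le_mul_of_nonneg_left hsu hB0
      _ < ε := by
          rw [hδ]
          have : B * (ε / (2 * (B + 1))) = ε * (B / (2 * (B + 1))) := by ring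
          rw [this]
          have hfrac : B / (2 * (B + 1)) < 1 := by
            rw [div_lt_one (by positivity)]; linarith
          calc ε * (B / (2 * (B + 1))) < ε * 1 := mul_lt_mul_of_pos_left hfrac hε
            _ = ε := mul_one ε
  obtain ⟨L, hL⟩ := CompleteSpace.complete hC
  exact ⟨L, hL⟩

/-- **S5: TERMINAL TRACES EXIST AND INHERIT THE `ℓ³` BOUND.** In the crux's class (the `ℓ³`
bound gives a critical sup bound `max M 1`, hence bounded derivatives near `T`,
`terminalTrace_limit`), every mode has a limit `τ_{i,n}` at `T⁻`, and by passing to the limit in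
each finite sum (`le_of_tendsto` along the non-trivial filter `𝓝[<] T`, on whose member `[0,T)`
the sums are `≤ M`) `Σ_{n∈s}Σ_i (lam^{n/5}|τ_{i,n}|)³ ≤ M` for every finite `s`. The `ℓ³`
hypothesis is the one the disprover showed to be load-bearing: its failure at `t = T` is exactly
what a paced sequence of fronts would produce. -/
theorem stub_terminalTrace :
    ∀ lam : ℝ, 1 < lam → ∀ (m : ℕ) (coeff : Fin m → Fin m → Fin m → Option (Fin 3) → ℝ) (T M : ℝ)
    (X : Fin m → ℤ → ℝ → ℝ), 0 < T →
    (∀ (i : Fin m) (n : ℤ), ∀ t ∈ Set.Ioo 0 T, HasDerivAt (X i n) (circuitRHS lam coeff X i n t) t) →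
    (∀ (i : Fin m) (n : ℤ) (t : ℝ), n < 0 → X i n t = 0) →
    (∀ t ∈ Set.Ico 0 T, ∀ s : Finset ℤ,
      ∑ n ∈ s, ∑ i : Fin m, (lam ^ ((1 / 5 : ℝ) * n) * |X i n t|) ^ 3 ≤ M) →
    ∃ τ : Fin m → ℤ → ℝ,
      (∀ (i : Fin m) (n : ℤ), Filter.Tendsto (X i n) (nhdsWithin T (Set.Iio T)) (nhds (τ i n))) ∧
      ∀ s : Finset ℤ, ∑ n ∈ s, ∑ i : Fin m, (lam ^ ((1 / 5 : ℝ) * n) * |τ i n|) ^ 3 ≤ M := by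
  intro lam hlam m coeff T M X hT hderiv _hcut hM
  have hlam0 : 0 < lam := by linarith
  have hA : ∃ A : ℝ, ∀ (i : Fin m) (n : ℤ), ∀ t ∈ Set.Ico 0 T,
      lam ^ ((1 / 5 : ℝ) * n) * |X i n t| ≤ A :=
    ⟨max M 1, terminalTrace_critSupBound hlam0 hM⟩
  choose τ hτ using fun i n => terminalTrace_limit hlam coeff T X hT hderiv hA i n
  refine ⟨τ, hτ, fun s => ?_⟩
  have hlim : Filter.Tendsto
      (fun t => ∑ n ∈ s, ∑ i : Fin m, (lam ^ ((1 / 5 : ℝ) * n) * |X i n t|) ^ 3)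
      (nhdsWithin T (Set.Iio T))
      (nhds (∑ n ∈ s, ∑ i : Fin m, (lam ^ ((1 / 5 : ℝ) * n) * |τ i n|) ^ 3)) := by
    refine tendsto_finsetSum _ fun n _ => tendsto_finsetSum _ fun i _ => ?_
    exact ((hτ i n).abs.const_mul _).pow 3
  refine le_of_tendsto hlim ?_
  exact Filter.mem_of_superset (Ico_mem_nhdsLT hT) fun t ht => hM t ht s

end Summit.NavierStokesRegularity.NavierStokesRegularity.Theorems.PerpetualPumpCircuitTrace

end
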